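import Summits.BirchSwinnertonDyer.BirchSwinnertonDyer.Theorems.SchneiderFreeAdditiveX3KYReadLogDescent
import Summits.BirchSwinnertonDyer.Rank1Residual.X11b.EmbeddingDatumPrime
import Literature.NumberTheory.EllipticCurves.LiuZhangZhang2018.PAdicWaldspurgerEllipticCurveAdditiveRamifiedTwisted
import Literature.NumberTheory.EllipticCurves.PadicLogFiniteExtensionLocalFieldProofs
import Literature.AlgebraicGeometry.Resolution.DefectlessDedekind
import HarnessLib
import HarnessLib.Audit.Tags

/-!
# Route `AdditiveBranchIMC`, crux `GordTwoRankZeroOffCaseOne` (stmt-BirchSwinnertonDyer-19357), line `three_field_road`: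
# THE TWISTED ROAD — number-field points read in `ℂ_p` have a positive multiple in the level, and the `ν`-weighted
# logarithm sum of reading R4 is the logarithm of the `ν`-twisted trace

Cell `bsd-addord` (HOME `run/shared/lean/pub/bsd-addord/`), seat `cruxlead-19357` gen 16; `--supports stmt-BirchSwinnertonDyer-19357`
(helper toward the registered kernel stub `stub_logTransportTwistedR0 : LogTransportTwistedR0` of the skeleton v41). HONEST FRAMING: plumbing
about `p`-adic logarithms of points; nothing about `L`-functions; BSD is not advanced; the crux stays OPEN.

## What is here
* §1 `exists_nsmul_mem_level_of_numberField` — for a number field `H` and ANY valuation `w : H → ℝ≥0` with `w ≤ 1` on `𝓞 H` and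
  `w(p) < 1`, every point of an elliptic `w`-integral Weierstrass equation over `H` has a positive multiple in the level
  `E⁽ᵖ⁾ = {P ∈ E₁ : |z(P)| ≤ |p|}`. Proof: the valuation ring of `w` contains the Dedekind domain `𝓞 H` and is proper, so it is a
  localisation `(𝓞 H)_𝔓` (tree `Resolution.exists_eq_valuationSubringAtPrime_of_le`), a discrete valuation ring with finite residue
  field; then the tree's uniform domain lemma `FormalGroupChart.exists_nsmul_mem_level_of_Δ_ne_zero` (`E(H)/E₁(H)` finite by
  pigeonhole — completeness is not needed) applies.
* §1 `exists_nsmul_map_mem_level_of_ringHom` — hence along any ring map `ρ : H → F` into a nonarchimedean normed field with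
  `‖ρ(𝓞 H)‖ ≤ 1`, `‖p‖_F < 1` (MEANT: `F = ℂ_p`, `ρ = ι′⁻¹|_H`), the image of every `H`-point of `X ⊗ H` (`X/ℚ`) has a positive
  multiple in the level of `X ⊗ F` (`map_mem_level_of_val_eq` for the pulled-back valuation `w = ‖ρ ·‖`), so that
  `padicLogPointFiniteExt` takes its genuine value there and is additive on such points.
* §2 `padicLogPointFiniteExt_sum_units_zsmul` — over a complete nonarchimedean field, `log_ω(Σ_i s_i P_i) = Σ_i s_i log_ω(P_i)` for
  signs `s_i = ±1` and points with positive multiples in the level (induction on `padicLogPointFiniteExt_add/neg`).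
* §3 `heegnerCharLogSum_eq_padicLog_map_sum` — for a `{±1}`-valued character `ν = s` of `Gal(K[c]/K)`:
  `LiuZhangZhang2018.heegnerCharLogSum ι′ ι_K c W₁ ν y = log_{ω_{W₁}}((Σ_τ s(τ)·τy)_{ℂ_p})`, the point read along
  `ringClassFieldToPadicComplex ι′ ι_K c`, together with a positive multiple of that point in the level.

References: Silverman *AEC* IV.3.2, IV.6.4, VII.2.1–2.2, VII.6 Cor. 6.2 / Ex. 7.6; Neukirch ANT II §8 (valuations of a number
field are the `𝔓`-adic ones); Liu–Zhang–Zhang, Duke 167 (2018) (1.5) (the finite sum `P_{ℂ_p}(φ, χ)`).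
-/

noncomputable section

open scoped Classical NNReal

open WeierstrassCurve NumberField IsDedekindDomain Field
  Literature.NumberTheory.EllipticCurves
  Literature.NumberTheory.EllipticCurves.FormalGroupChart
  Literature.NumberTheory.EllipticCurves.LiuZhangZhang2018
  Summit.BirchSwinnertonDyer.Rank1Residual

set_option linter.dupNamespace false
set_option autoImplicit false

namespace Summit.BirchSwinnertonDyer.BirchSwinnertonDyer.Theorems.TwistedWanRoad

/-! ## §1 Number-field points have a positive multiple in the level -/

section NumberFieldLevel

variable {H : Type} [Field H] [NumberField H]

/-- **Every point of an elliptic curve over a number field has a positive multiple in the level `E⁽ᵖ⁾` of any valuation bounded by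
one on the integers with `|p| < 1`.** For `w : H → ℝ≥0` with `w(𝓞 H) ≤ 1` and `w(p) < 1`, the valuation ring `{w ≤ 1}` contains
`𝓞 H` and is not all of `H`, hence is the localisation `(𝓞 H)_𝔓` at a non-zero prime (the valuation rings of `Frac A ⊇ A`, `A`
Dedekind, are `Frac A` and the `A_𝔭`) — a discrete valuation ring with finite residue field `𝓞 H/𝔓` — and the tree's uniform domain
lemma (`E(H)/E₁(H)` finite by pigeonhole modulo `𝔪^N`, no completeness) gives the multiple.
[cite: SilvermanAEC2009, VII.6 Cor. 6.2 and Exercise 7.6; Prop. IV.3.2 with Prop. VII.2.2] [cite: NeukirchANT1999, Ch. II §8] -/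
theorem exists_nsmul_mem_level_of_numberField (w : Valuation H ℝ≥0) (hint : ∀ k : 𝓞 H, w (k : H) ≤ 1)
    {p : ℕ} (hp : p.Prime) (hwp : w (p : H) < 1)
    (V : WeierstrassCurve H) [V.IsElliptic] [hV : V.IsIntegral w.integer] (P : V.toAffine.Point) :
    ∃ m : ℕ, 0 < m ∧ m • P ∈ level w V (w (p : H)) := by
  have hp0 : (p : H) ≠ 0 := Nat.cast_ne_zero.mpr hp.ne_zero
  -- the valuation ring of `w`: contains `𝓞 H`, proper
  set O : ValuationSubring H := w.valuationSubring with hOdef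
  have hmemO : ∀ x : H, x ∈ O ↔ w x ≤ 1 := fun x ↦ Valuation.mem_valuationSubring_iff w x
  have hA : ∀ a : 𝓞 H, algebraMap (𝓞 H) H a ∈ O := fun a ↦ (hmemO _).mpr (hint a)
  have hOtop : O ≠ ⊤ := by
    intro h
    have hmem : (p : H)⁻¹ ∈ O := by rw [h]; exact ValuationSubring.mem_top _
    have hle : w ((p : H)⁻¹) ≤ 1 := (hmemO _).mp hmem
    rw [map_inv₀] at hle
    have hpos : 0 < w (p : H) := (Valuation.pos_iff w).mpr hp0
    exact absurd hle (not_le.mpr ((one_lt_inv₀ hpos).mpr hwp))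
  -- hence `O = (𝓞 H)_𝔓`
  obtain ⟨𝔓, h𝔓⟩ :=
    Literature.AlgebraicGeometry.Resolution.exists_eq_valuationSubringAtPrime_of_le (A := 𝓞 H) O hA hOtop
  have hmemR : ∀ x : H, x ∈ HeightOneSpectrum.valuationSubringAtPrime H 𝔓 ↔ w x ≤ 1 := fun x ↦ by
    rw [h𝔓]; exact hmemO x
  -- `(𝓞 H)_𝔓` is a discrete valuation ring with finite residue field
  haveI : IsDiscreteValuationRing (HeightOneSpectrum.valuationSubringAtPrime H 𝔓) :=
    IsLocalization.AtPrime.isDiscreteValuationRing_of_dedekind_domain (𝓞 H) 𝔓.ne_bot _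
  haveI : 𝔓.asIdeal.IsMaximal := 𝔓.isMaximal
  haveI : Finite (𝓞 H ⧸ 𝔓.asIdeal) := Ideal.finiteQuotientOfFreeOfNeBot _ 𝔓.ne_bot
  haveI : Finite (IsLocalRing.ResidueField (HeightOneSpectrum.valuationSubringAtPrime H 𝔓)) :=
    Finite.of_equiv _
      (IsLocalization.AtPrime.equivQuotMaximalIdeal 𝔓.asIdeal (HeightOneSpectrum.valuationSubringAtPrime H 𝔓)).toEquiv
  have hR : ∀ x : H, w x ≤ 1 →
      x ∈ Set.range (algebraMap (HeightOneSpectrum.valuationSubringAtPrime H 𝔓) H) :=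
    fun x hx ↦ ⟨⟨x, (hmemR x).mpr hx⟩, rfl⟩
  -- an `(𝓞 H)_𝔓`-model of `V`
  have m₁ := (hmemR _).mpr (val_a₁_le_one (w := w) (V := V))
  have m₂ := (hmemR _).mpr (val_a₂_le_one (w := w) (V := V))
  have m₃ := (hmemR _).mpr (val_a₃_le_one (w := w) (V := V))
  have m₄ := (hmemR _).mpr (val_a₄_le_one (w := w) (V := V))
  have m₆ := (hmemR _).mpr (val_a₆_le_one (w := w) (V := V))
  obtain ⟨W₀, hW₀⟩ : ∃ W₀ : WeierstrassCurve (HeightOneSpectrum.valuationSubringAtPrime H 𝔓),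
      W₀.baseChange H = V :=
    ⟨⟨⟨V.a₁, m₁⟩, ⟨V.a₂, m₂⟩, ⟨V.a₃, m₃⟩, ⟨V.a₄, m₄⟩, ⟨V.a₆, m₆⟩⟩, rfl⟩
  subst hW₀
  have hΔ : W₀.Δ ≠ 0 := by
    intro h0
    apply (W₀.baseChange H).Δ'.ne_zero
    rw [coe_Δ', baseChange, map_Δ, h0, map_zero]
  exact exists_nsmul_mem_level_of_Δ_ne_zero hR W₀ hΔ hp0 P

end NumberFieldLevel

section Integrality

variable {H : Type} [Field H] [CharZero H] {F : Type} [NontriviallyNormedField F] [IsUltrametricDist F]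

omit [CharZero H] in
/-- A Weierstrass equation with integer coefficients, base-changed to `H`, is integral for the valuation `‖ρ ·‖` pulled back along any
ring map `ρ : H → F` into a nonarchimedean normed field (`‖n‖ ≤ 1` for integers `n`). [cite: SilvermanAEC2009, VII.1] -/
theorem isIntegral_comap_baseChange_int (ρ : H →+* F) (X₀ : WeierstrassCurve ℤ) :
    (X₀.baseChange H).IsIntegral ((NormedField.valuation (K := F)).comap ρ).integer := by
  have hmem : ∀ a : ℤ, algebraMap ℤ H a ∈ ((NormedField.valuation (K := F)).comap ρ).integer := fun a ↦ by
    change NormedField.valuation (ρ (algebraMap ℤ H a)) ≤ 1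
    rw [eq_intCast, map_intCast, NormedField.valuation_apply, ← NNReal.coe_le_coe, coe_nnnorm, NNReal.coe_one]
    exact IsUltrametricDist.norm_intCast_le_one F a
  exact WeierstrassCurve.isIntegral_of_exists_lift _ ⟨⟨_, hmem X₀.a₁⟩, rfl⟩ ⟨⟨_, hmem X₀.a₂⟩, rfl⟩
    ⟨⟨_, hmem X₀.a₃⟩, rfl⟩ ⟨⟨_, hmem X₀.a₄⟩, rfl⟩ ⟨⟨_, hmem X₀.a₆⟩, rfl⟩

/-- A globally minimal `X/ℚ`, base-changed to `H`, is integral for `‖ρ ·‖` (its `ℤ`-model base-changed).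
[cite: SilvermanAEC2009, VII.1 and VIII.8] -/
theorem isIntegral_comap_baseChange (ρ : H →+* F) (X : WeierstrassCurve ℚ) [X.IsGloballyMinimal] :
    (X.baseChange H).IsIntegral ((NormedField.valuation (K := F)).comap ρ).integer := by
  have h := isIntegral_comap_baseChange_int ρ (integralModelInt X)
  have e' : (integralModelInt X).baseChange H = X.baseChange H := by
    conv_rhs => rw [← map_integralModelInt X]
    rw [WeierstrassCurve.baseChange, WeierstrassCurve.baseChange, WeierstrassCurve.map_map]
    congr 1
    exact Subsingleton.elim _ _
  rwa [e'] at h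

end Integrality

section RingHomLevel

variable {H : Type} [Field H] [NumberField H] {F : Type} [NontriviallyNormedField F] [IsUltrametricDist F] [CharZero F]

/-- **Along `ρ : H → F` (MEANT: `F = ℂ_p`, `ρ = ι′⁻¹|_H`) the image of every `H`-point has a positive multiple in the level of
`X ⊗ F`**, for `X/ℚ` globally minimal, `‖ρ(𝓞 H)‖ ≤ 1` and `‖p‖_F < 1`: §1 for the pulled-back valuation `‖ρ ·‖` on `H`, transported by
the isometry `ρ` (`map_mem_level_of_val_eq`). So `padicLogPointFiniteExt ‖·‖ (X ⊗ F) p` takes its genuine value at such points.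
[cite: SilvermanAEC2009, Prop. IV.3.2 with Prop. VII.2.2 and VII.6 Ex. 7.6] -/
theorem exists_nsmul_map_mem_level_of_ringHom (ρ : H →+* F) (hρ : ∀ k : 𝓞 H, ‖ρ (k : H)‖ ≤ 1)
    {p : ℕ} (hp : p.Prime) (hpF : ‖(p : F)‖ < 1) (X : WeierstrassCurve ℚ) [X.IsElliptic] [X.IsGloballyMinimal]
    [(X.baseChange F).IsIntegral (NormedField.valuation (K := F)).integer] (P : (X.baseChange H).toAffine.Point) :
    ∃ m : ℕ, 0 < m ∧ m • WeierstrassCurve.Affine.Point.map ρ.toRatAlgHom P ∈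
      level NormedField.valuation (X.baseChange F) (NormedField.valuation (p : F)) := by
  set w : Valuation H ℝ≥0 := (NormedField.valuation (K := F)).comap ρ with hwdef
  have hw : ∀ x : H, w x = NormedField.valuation (ρ x) := fun x ↦ rfl
  haveI := isIntegral_comap_baseChange ρ X
  haveI : (X.baseChange H).IsElliptic := by rw [WeierstrassCurve.baseChange]; infer_instance
  have hint : ∀ k : 𝓞 H, w (k : H) ≤ 1 := fun k ↦ by
    rw [hw, NormedField.valuation_apply, ← NNReal.coe_le_coe, coe_nnnorm, NNReal.coe_one]
    exact hρ k
  have hwp : w (p : H) < 1 := by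
    rw [hw, map_natCast, NormedField.valuation_apply, ← NNReal.coe_lt_coe, coe_nnnorm, NNReal.coe_one]
    exact hpF
  obtain ⟨m, hm, hmP⟩ := exists_nsmul_mem_level_of_numberField w hint hp hwp (X.baseChange H) P
  refine ⟨m, hm, ?_⟩
  rw [← map_nsmul]
  exact map_mem_level_of_val_eq (X := X) (ι := ρ.toRatAlgHom) (fun x ↦ (hw x).symm) hmP

end RingHomLevel

/-! ## §2 The logarithm of a signed sum -/

section SignedSum

variable {F : Type*} [NontriviallyNormedField F] [IsUltrametricDist F] [CompleteSpace F]
  {V : WeierstrassCurve F} [hV : V.IsIntegral (NormedField.valuation (K := F)).integer] {p : ℕ}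

/-- **`log_ω(Σ_i s_i • P_i) = Σ_i s_i · log_ω(P_i)` for signs `s_i ∈ {±1}`** and points `P_i` each having a positive multiple in the
level, over a complete nonarchimedean field; together with a positive multiple of the signed sum in the level (so that the sum can be
extended). Induction on `padicLogPointFiniteExt_add` / `_neg`. [cite: SilvermanAEC2009, Thm. IV.6.4(a) with Prop. VII.2.2]
[cite: MazurTateTeitelbaum1986, §II] -/
theorem padicLogPointFiniteExt_sum_units_zsmul (hp0 : (p : F) ≠ 0) (hp1 : NormedField.valuation (p : F) < 1)
    {ι : Type*} (t : Finset ι) (P : ι → V.toAffine.Point) (s : ι → ℤˣ)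
    (hP : ∀ i ∈ t, ∃ m : ℕ, 0 < m ∧ m • P i ∈ level NormedField.valuation V (NormedField.valuation (p : F))) :
    (∃ n : ℕ, 0 < n ∧ n • (∑ i ∈ t, ((s i : ℤ)) • P i) ∈ level NormedField.valuation V (NormedField.valuation (p : F))) ∧
      padicLogPointFiniteExt NormedField.valuation V p (∑ i ∈ t, ((s i : ℤ)) • P i) =
        ∑ i ∈ t, ((s i : ℤ) : F) * padicLogPointFiniteExt NormedField.valuation V p (P i) := by
  have hℓ := limitLog_spec_of_completeSpace (V := V) hp0 hp1
  induction t using Finset.induction_on with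
  | empty =>
    refine ⟨⟨1, Nat.one_pos, ?_⟩, ?_⟩
    · rw [Finset.sum_empty, nsmul_zero]; exact AddSubgroup.zero_mem _
    · rw [Finset.sum_empty, Finset.sum_empty, padicLogPointFiniteExt_zero hp0 hp1 hℓ]
  | @insert a t ha ih =>
    obtain ⟨⟨n, hn, hnS⟩, hlog⟩ := ih (fun i hi ↦ hP i (Finset.mem_insert_of_mem hi))
    obtain ⟨m, hm, hmP⟩ := hP a (Finset.mem_insert_self a t)
    -- a multiple of `s_a • P_a` in the level, and its logarithm
    have hma : m • (((s a : ℤ)) • P a) ∈ level NormedField.valuation V (NormedField.valuation (p : F)) := by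
      rw [smul_comm]; exact AddSubgroup.zsmul_mem _ hmP _
    have hsa : padicLogPointFiniteExt NormedField.valuation V p (((s a : ℤ)) • P a) =
        ((s a : ℤ) : F) * padicLogPointFiniteExt NormedField.valuation V p (P a) := by
      rcases Int.units_eq_one_or (s a) with h | h
      · rw [h, Units.val_one, one_zsmul, Int.cast_one, one_mul]
      · rw [h, Units.val_neg, Units.val_one, neg_one_zsmul, padicLogPointFiniteExt_neg hp0 hp1 hℓ hm hmP,
          Int.cast_neg, Int.cast_one, neg_one_mul]
    refine ⟨⟨m * n, Nat.mul_pos hm hn, ?_⟩, ?_⟩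
    · rw [Finset.sum_insert ha, nsmul_add]
      refine AddSubgroup.add_mem _ ?_ ?_
      · rw [mul_nsmul]; exact AddSubgroup.nsmul_mem _ hma n
      · rw [mul_nsmul']; exact AddSubgroup.nsmul_mem _ hnS m
    · rw [Finset.sum_insert ha, Finset.sum_insert ha, padicLogPointFiniteExt_add hp0 hp1 hℓ hm hma hn hnS, hlog, hsa]

end SignedSum

/-! ## §3 Reading R4's weighted logarithm sum as the logarithm of the twisted trace -/

section CharLogSum

variable (p : ℕ) [Fact p.Prime] {K : Type} [Field K] [NumberField K]

/-- Integers of the ring class field have norm `≤ 1` in `ℂ_p` along `ringClassFieldToPadicComplex ι′ ι_K c = ι′⁻¹|_{K[c]}`.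
[folklore] -/
theorem norm_ringClassFieldToPadicComplex_le_one (ι' : PadicAlgCl p ≃+* ℂ) (ιK : K →+* ℂ) (c : ℕ)
    [NumberField (ringClassField K ιK c)] (k : 𝓞 (ringClassField K ιK c)) :
    ‖ringClassFieldToPadicComplex ι' ιK c (k : ringClassField K ιK c)‖ ≤ 1 := by
  change ‖algebraMap (PadicAlgCl p) ℂ_[p] (ι'.symm.toRingHom ((ringClassField K ιK c).subtype k))‖ ≤ 1
  rw [← PadicComplex.coe_eq, PadicComplex.norm_extends]
  exact X11b.norm_padicEmbOfDatum_le_one p ι' (ringClassField K ιK c).subtype k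

/-- **The `ν`-weighted logarithm sum of reading R4 IS the logarithm of the `ν`-twisted trace.** For a character `ν` of `Gal(K[c]/K)`
with values `s ∈ {±1}` and a point `y ∈ W₁(K[c])` (`W₁/ℚ` globally minimal):
`heegnerCharLogSum ι′ ι_K c W₁ ν y = Σ_τ ν(τ)·log_{ω_{W₁}}((τy)_{ℂ_p}) = log_{ω_{W₁}}((Σ_τ s(τ)·τy)_{ℂ_p})`, the points read in
`W₁(ℂ_p)` along `ringClassFieldToPadicComplex ι′ ι_K c` — every conjugate has a positive multiple in the level (§1), so the logarithm
is additive on them (§2) — and the twisted trace read in `ℂ_p` has a positive multiple in the level.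
[cite: LiuZhangZhang2018, (1.5) and §1.3 (Duke 167 pp. 746–747)] [cite: SilvermanAEC2009, Thm. IV.6.4(a) with Prop. VII.2.2] -/
theorem heegnerCharLogSum_eq_padicLog_map_sum (ι' : PadicAlgCl p ≃+* ℂ) (ιK : K →+* ℂ) (c : ℕ)
    (W₁ : WeierstrassCurve ℚ) [W₁.IsElliptic] [W₁.IsGloballyMinimal]
    [(W₁.baseChange ℂ_[p]).IsIntegral (NormedField.valuation (K := ℂ_[p])).integer]
    [NumberField (ringClassField K ιK c)] [Fintype (ringClassGal ιK c)]
    (ν : ringClassGal ιK c →* ℂˣ) (s : ringClassGal ιK c → ℤˣ) (hν : ∀ σ, ((ν σ : ℂˣ) : ℂ) = ((s σ : ℤ) : ℂ))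
    (y : (W₁.baseChange (ringClassField K ιK c : Type)).toAffine.Point) :
    (∃ n : ℕ, 0 < n ∧ n • WeierstrassCurve.Affine.Point.map (ringClassFieldToPadicComplex ι' ιK c).toRatAlgHom
        (∑ τ : ringClassGal ιK c, (s τ : ℤ) • pointGalHom W₁ (ringClassField K ιK c : Type) τ.1 y) ∈
        level NormedField.valuation (W₁.baseChange ℂ_[p]) (NormedField.valuation (p : ℂ_[p]))) ∧
    heegnerCharLogSum ι' ιK c W₁ ν y =
      padicLogPointFiniteExt NormedField.valuation (W₁.baseChange ℂ_[p]) p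
        (WeierstrassCurve.Affine.Point.map (ringClassFieldToPadicComplex ι' ιK c).toRatAlgHom
          (∑ τ : ringClassGal ιK c, (s τ : ℤ) • pointGalHom W₁ (ringClassField K ιK c : Type) τ.1 y)) := by
  have hp : p.Prime := Fact.out
  set ρ := ringClassFieldToPadicComplex (p := p) ι' ιK c with hρdef
  have hp0 : (p : ℂ_[p]) ≠ 0 := Nat.cast_ne_zero.mpr hp.ne_zero
  -- `‖p‖ < 1` in `ℂ_p` (tree: `norm_prime_padicComplex_lt_one`, inlined to keep the imports light)
  have hpF : ‖(p : ℂ_[p])‖ < 1 := by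
    rw [← map_natCast (algebraMap ℚ_[p] ℂ_[p]) p, norm_algebraMap']
    exact Padic.norm_p_lt_one
  have hp1 : NormedField.valuation (p : ℂ_[p]) < 1 := by
    rw [NormedField.valuation_apply, ← NNReal.coe_lt_coe, coe_nnnorm, NNReal.coe_one]
    exact hpF
  have hlev : ∀ τ : ringClassGal ιK c, ∃ m : ℕ, 0 < m ∧
      m • WeierstrassCurve.Affine.Point.map ρ.toRatAlgHom (pointGalHom W₁ (ringClassField K ιK c : Type) τ.1 y) ∈
        level NormedField.valuation (W₁.baseChange ℂ_[p]) (NormedField.valuation (p : ℂ_[p])) := fun τ ↦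
    exists_nsmul_map_mem_level_of_ringHom ρ (norm_ringClassFieldToPadicComplex_le_one p ι' ιK c) hp hpF W₁ _
  obtain ⟨hn, hlog⟩ := padicLogPointFiniteExt_sum_units_zsmul hp0 hp1 (Finset.univ : Finset (ringClassGal ιK c))
    (fun τ ↦ WeierstrassCurve.Affine.Point.map ρ.toRatAlgHom (pointGalHom W₁ (ringClassField K ιK c : Type) τ.1 y)) s
    (fun τ _ ↦ hlev τ)
  have hmap : WeierstrassCurve.Affine.Point.map ρ.toRatAlgHom
      (∑ τ : ringClassGal ιK c, (s τ : ℤ) • pointGalHom W₁ (ringClassField K ιK c : Type) τ.1 y) =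
      ∑ τ : ringClassGal ιK c, (s τ : ℤ) •
        WeierstrassCurve.Affine.Point.map ρ.toRatAlgHom (pointGalHom W₁ (ringClassField K ιK c : Type) τ.1 y) := by
    rw [map_sum]
    exact Finset.sum_congr rfl fun τ _ ↦ map_zsmul _ _ _
  refine ⟨by rw [hmap]; exact hn, ?_⟩
  rw [hmap, hlog, heegnerCharLogSum, finsum_eq_sum_of_fintype]
  refine Finset.sum_congr rfl fun τ _ ↦ ?_
  rw [hν τ, map_intCast, PadicComplex.coe_eq, map_intCast]

end CharLogSum

end Summit.BirchSwinnertonDyer.BirchSwinnertonDyer.Theorems.TwistedWanRoad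

end
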